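import Summits.Langlands.Langlands.Theorems.IrreducibilityBySelfDualityReciprocityUpToIrreducibilityWeakExistenceAll
import Summits.Langlands.Langlands.Theorems.IrreducibilityBySelfDualityReciprocityUpToIrreducibilityRankOneCuspidalModel
import Literature.NumberTheory.GaloisRepresentations.WeakAbelianDirectSummandTwistProofs
import HarnessLib

/-!
# Line `Sketch` for the crux `ReciprocityUpToIrreducibility` (item stmt-Langlands-14328), wave N11-J:
# weak automorphy of `(open kernel) ⊗ ε_ℓ^k` in rank one

Support file (closes nothing; stub `stub_rankOne_weakAutomorphy_of_isOpen_ker_twist` of the registered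
skeleton of line `Sketch`, continuation lead c9).  It is the (B)-side ("Galois ⇒ automorphic", weak
form) twin of the accepted `weakExistence_rankOne_of_isFiniteOrder_normTwist_all`
(`…WeakExistenceAll`, wave N10-F), whose Frobenius bookkeeping it repeats verbatim.

Let `r : Γ_K → GL₁(ℚ̄_ℓ)` have OPEN KERNEL, let `ε : Γ_K →ₜ* ℚ̄_ℓˣ` be the `k`-th power of the `ℓ`-adic
cyclotomic character (`ε(σ) = χ_ℓ(σ)^k`, `k ∈ ℤ`) and `ι : ℚ̄_ℓ ≃+* ℂ`.  Then `r ⊗ ε` is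
Satake–Frobenius compatible (`SatakeFrobCompatibleAt`) at all but finitely many places with a
cuspidal, L-algebraic automorphic representation datum `π` of `GL₁(𝔸_K)`:

* Artin reciprocity for linear characters (`FramedGaloisRep.exists_heckeCharacter_of_isOpen_ker`,
  proved in the tree) gives a finite-order, hence algebraic, Hecke character `χ` with
  `char r(Frob_v) = X - ι⁻¹(χ(ϖ_v))⁻¹` at every place where `r` is unramified — which is almost
  everywhere (`FramedGaloisRep.eventually_isUnramifiedAt_of_isOpen_ker`);
* `π = π_θ = ℂ·(θ ∘ det)/⊥` for `θ = χ · ‖·‖^k` (Borel–Jacquet model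
  `exists_automorphicRepData_detTwist_glOne`; cuspidal, `cuspidal_detTwist_glOne_le`; Hecke character
  `θ`, `heckeCharacter_detTwist_glOne`);
* `π_θ` is L-algebraic because `θ` is algebraic (`isLAlgebraic_glOne_of_isAlgebraic_heckeCharacter`:
  an infinity type `(p, q)` of `θ` gives `π_θ` the infinity type `ι ↦ {(-n_ι, -n_ῑ)}` with integral
  exponents, `AutomorphicRepData.exists_hasInfinityType_of_hasInfinityType_heckeCharacter_glOne`;
  `θ` is algebraic by `HeckeCharacter.IsFiniteOrder.isAlgebraic`, `isAlgebraic_normCharacter` and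
  `IsAlgebraic.mul/.inv`);
* at a place `v ∤ ℓ` at which `π_θ` has a Satake parameter and `r` is unramified, the parameter is
  `{θ(ϖ_v)} = {χ(ϖ_v) · q_v^{-k}}` (`exists_eq_singleton_of_hasSatakeParamAt_glOne`,
  `valueAtUniformizer_normCharacter`), `r ⊗ ε` is unramified (`isUnramifiedAt_twist`,
  `eq_one_of_mem_inertia_of_cyclotomic_zpow`) and
  `(r ⊗ ε)(Frob_v) = q_v^k · ι⁻¹(χ(ϖ_v))⁻¹ = ι⁻¹(θ(ϖ_v))⁻¹` (`hasFrobCharpolyAt_twist_of_eq_prod`,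
  `coe_apply_of_isArithFrobAt_of_cyclotomic_zpow`), i.e. `char (r ⊗ ε)(Frob_v) =
  arithFrobPolyOfSatake ι q_v 1 {θ(ϖ_v)}` (`arithFrobPolyOfSatake_one`).

No definitions; standard axioms only; no named fact.
-/

noncomputable section

set_option linter.dupNamespace false -- project-wide option (lakefile weak.linter.dupNamespace); `Summit.Langlands.Langlands` is the mandated namespace

open scoped MatrixGroups Matrix NumberField Classical Polynomial
open Filter IsDedekindDomain Field Polynomial
open Literature.NumberTheory.Automorphic Literature.NumberTheory.GaloisRepresentations
open Literature.NumberTheory.PAdicHodge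
open Summit.Langlands

namespace Summit.Langlands.Langlands.Theorems.ReciprocityUpToIrreducibility

variable {K : Type} [Field K] [NumberField K] {ℓ : ℕ} [Fact ℓ.Prime]

/-! ## 1. Integer powers of algebraic Hecke characters; L-algebraicity of a `GL₁` datum with
algebraic Hecke character -/

/-- **Natural powers of an algebraic Hecke character are algebraic** (infinity types add under
products, `HeckeCharacter.IsAlgebraic.mul`; the trivial character is algebraic,
`HeckeCharacter.isAlgebraic_one`). [cite: SerreAbelianLadic1968, Ch. II §2.4] -/
theorem heckeCharacter_isAlgebraic_pow {χ : HeckeCharacter K} (h : χ.IsAlgebraic) (n : ℕ) :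
    (χ ^ n).IsAlgebraic := by
  induction n with
  | zero =>
    rw [pow_zero]
    exact HeckeCharacter.isAlgebraic_one
  | succ n ih =>
    rw [pow_succ]
    exact ih.mul h

/-- **Integer powers of an algebraic Hecke character are algebraic** (`heckeCharacter_isAlgebraic_pow`
and `HeckeCharacter.IsAlgebraic.inv`). [cite: SerreAbelianLadic1968, Ch. II §2.4] -/
theorem heckeCharacter_isAlgebraic_zpow {χ : HeckeCharacter K} (h : χ.IsAlgebraic) (k : ℤ) :
    (χ ^ k).IsAlgebraic := by
  obtain ⟨n, rfl | rfl⟩ := k.eq_nat_or_neg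
  · rw [zpow_natCast]
    exact heckeCharacter_isAlgebraic_pow h n
  · rw [zpow_neg, zpow_natCast]
    exact (heckeCharacter_isAlgebraic_pow h n).inv

/-- **A `GL₁` datum with ALGEBRAIC Hecke character is L-algebraic.**  If every `g ∈ GL₁(𝔸_K)` acts
on `W / W'` by `θ(det g)` with `θ` algebraic, of infinity type `(p, q)`
(`HeckeCharacter.isAlgebraic_iff_exists_hasInfinityType`), then `π` has the infinity type
`ι ↦ {(-n_ι, -n_ῑ)}` (`AutomorphicRepData.exists_hasInfinityType_of_hasInfinityType_heckeCharacter_glOne`),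
whose exponents are integers (`a = -n_ι ∈ ℤ`, `a - b ∈ ℤ` by `ArchWeight.exists_int_sub`) — the proof
of `isLAlgebraic_detTwist_glOne_of_isFiniteOrder` (c4), which only used the algebraicity of `θ`.
[cite: BuzzardGeeLMS2014, Def. 3.1.1] [cite: Clozel1990, §3.3] -/
theorem isLAlgebraic_glOne_of_isAlgebraic_heckeCharacter {hcpt : isCompact_glFiniteIntegralLevel 1 K}
    (π : AutomorphicRepData (AutomorphyDatum.gl 1 K hcpt)) {θ : HeckeCharacter K}
    (hχ : ∀ (g : (AdelicGroupData.gl 1 K).Adelic), ∀ φ ∈ π.W,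
      rightTranslation (AdelicGroupData.gl 1 K) g φ -
        ((θ (Matrix.GeneralLinearGroup.det g) : ℂˣ) : ℂ) • φ ∈ π.W')
    (hθ : θ.IsAlgebraic) : π.IsLAlgebraic := by
  classical
  obtain ⟨p, q, hpq⟩ := (θ.isAlgebraic_iff_exists_hasInfinityType).mp hθ
  obtain ⟨T, hT, hTa⟩ := π.exists_hasInfinityType_of_hasInfinityType_heckeCharacter_glOne hχ hpq
  refine ⟨T, hT, fun σ w hw => ?_⟩
  have ha : w.a = -((HeckeCharacter.embExponent p q σ : ℤ) : ℂ) := by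
    have hmem : w.a ∈ (T σ).map ArchWeight.a := Multiset.mem_map_of_mem _ hw
    rw [hTa σ] at hmem
    exact Multiset.mem_singleton.mp hmem
  obtain ⟨m, hm⟩ := w.exists_int_sub
  refine ⟨-HeckeCharacter.embExponent p q σ, -HeckeCharacter.embExponent p q σ - m, ?_, ?_⟩
  · rw [ha]
    push_cast
    ring
  · have hb : w.b = w.a - m := by rw [← hm]; ring
    rw [hb, ha]
    push_cast
    ring

/-! ## 2. Weak automorphy of `(open kernel) ⊗ ε_ℓ^k` in rank one -/

/-- **Weak automorphy (direction (B), weak form) of `r ⊗ ε_ℓ^k` for `r : Γ_K → GL₁(ℚ̄_ℓ)` with open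
kernel.**  Let `r` have open kernel, `ε(σ) = χ_ℓ(σ)^k` (`k ∈ ℤ`) and `ι : ℚ̄_ℓ ≃+* ℂ`.  Then there is a
cuspidal, L-algebraic automorphic representation datum `π` of `GL₁(𝔸_K)` which is Satake–Frobenius
compatible with `r ⊗ ε` at all but finitely many places: `r` is the `ℓ`-adic avatar of a finite-order
Hecke character `χ` (Artin reciprocity, `FramedGaloisRep.exists_heckeCharacter_of_isOpen_ker`),
unramified almost everywhere (`FramedGaloisRep.eventually_isUnramifiedAt_of_isOpen_ker`), and
`π = ℂ·(θ ∘ det)/⊥` with `θ = χ · ‖·‖^k` (Borel–Jacquet model), L-algebraic since `θ` is algebraic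
(`isLAlgebraic_glOne_of_isAlgebraic_heckeCharacter`); at `v ∤ ℓ` unramified for `r` and `π`, the Satake
parameter is `{χ(ϖ_v) q_v^{-k}}` and `(r ⊗ ε)(Frob_v) = q_v^k ι⁻¹(χ(ϖ_v))⁻¹ = ι⁻¹(θ(ϖ_v))⁻¹`
(`hasFrobCharpolyAt_twist_of_eq_prod`, `coe_apply_of_isArithFrobAt_of_cyclotomic_zpow`,
`valueAtUniformizer_normCharacter`, `arithFrobPolyOfSatake_one`).
[cite: FontaineMazurGeometric1995, Conj. 1 (n = 1)] [cite: SerreAbelianLadic1968, Ch. I §1.2 and Ch. III §2.3]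
[cite: CasselsFrohlichANT1967, Ch. VII §5.1 Main Theorem (A)] [cite: BorelJacquet1979, 4.6] -/
theorem rankOne_weakAutomorphy_of_isOpen_ker_twist (hcpt : isCompact_glFiniteIntegralLevel 1 K)
    (ι : PadicAlgCl ℓ ≃+* ℂ) (r : FramedGaloisRep K (PadicAlgCl ℓ) 1)
    (hker : IsOpen (r.toMonoidHom.ker : Set (absoluteGaloisGroup K))) (k : ℤ)
    {ε : absoluteGaloisGroup K →ₜ* (PadicAlgCl ℓ)ˣ}
    (hε : ∀ σ, (ε σ : PadicAlgCl ℓ) =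
      (algebraMap ℚ_[ℓ] (PadicAlgCl ℓ) ((GaloisRep.cyclotomicCharacter K ℓ σ : ℤ_[ℓ]ˣ) : ℤ_[ℓ])) ^ k) :
    ∃ π : CuspidalAutomorphicRepData 1 K hcpt, π.1.IsLAlgebraic ∧
      ∀ᶠ v : HeightOneSpectrum (𝓞 K) in cofinite, SatakeFrobCompatibleAt ι π.1 (r.twist ε) v := by
  classical
  -- Artin reciprocity: the finite-order Hecke character of `r`
  obtain ⟨χ, halg, -, hr⟩ := r.exists_heckeCharacter_of_isOpen_ker hker ι
  -- the Borel–Jacquet datum `π_θ = ℂ·(θ ∘ det)/⊥` of `θ = χ ‖·‖^k`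
  obtain ⟨π₀, hW, -⟩ :=
    exists_automorphicRepData_detTwist_glOne hcpt (χ * HeckeCharacter.normCharacter K ^ k)
  have hχ : ∀ (g : (AdelicGroupData.gl 1 K).Adelic), ∀ φ ∈ π₀.W,
      rightTranslation (AdelicGroupData.gl 1 K) g φ -
        (((χ * HeckeCharacter.normCharacter K ^ k) (Matrix.GeneralLinearGroup.det g) : ℂˣ) : ℂ) • φ ∈
          π₀.W' :=
    ReciprocityUpToIrreducibility.heckeCharacter_detTwist_glOne _ hW
  have halgθ : (χ * HeckeCharacter.normCharacter K ^ k).IsAlgebraic :=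
    halg.mul (heckeCharacter_isAlgebraic_zpow HeckeCharacter.isAlgebraic_normCharacter k)
  refine ⟨⟨π₀, cuspidal_detTwist_glOne_le hcpt _ hW⟩,
    isLAlgebraic_glOne_of_isAlgebraic_heckeCharacter π₀ hχ halgθ, ?_⟩
  have hunrπ : ∀ᶠ v : HeightOneSpectrum (𝓞 K) in cofinite, π₀.IsUnramifiedAt v :=
    π₀.hasSatakeParamAt_cofinite_holds
  show ∀ᶠ v : HeightOneSpectrum (𝓞 K) in cofinite, SatakeFrobCompatibleAt ι π₀ (r.twist ε) v
  -- Satake–Frobenius compatibility at the places `v ∤ ℓ` unramified for `π₀` and `r`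
  filter_upwards [hunrπ, FramedGaloisRep.eventually_natCast_not_mem K ℓ,
    r.eventually_isUnramifiedAt_of_isOpen_ker hker] with v hv hvℓ hvr
  obtain ⟨α, hα⟩ := hv
  have hur₀ : χ.IsUnramifiedAt v := (hr v hvr).1
  refine ⟨α, hα, FramedGaloisRep.isUnramifiedAt_twist hvr
    (fun 𝔓 h𝔓 σ hσ => eq_one_of_mem_inertia_of_cyclotomic_zpow hε hvℓ h𝔓 hσ), ?_⟩
  obtain ⟨ϖ, hϖ, rfl⟩ := π₀.exists_eq_singleton_of_hasSatakeParamAt_glOne hχ hα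
  have hval : (((χ * HeckeCharacter.normCharacter K ^ k) (localUnits v ϖ) : ℂˣ) : ℂ) =
      χ.valueAtUniformizer v * ((v.residueCard : ℂ)⁻¹) ^ k := by
    rw [HeckeCharacter.mul_apply, Units.val_mul, heckeCharacter_zpow_apply,
      Units.val_zpow_eq_zpow_val, ← HeckeCharacter.localComponent_apply,
      ← HeckeCharacter.localComponent_apply,
      HeckeCharacter.localComponent_eq_valueAtUniformizer hur₀ hϖ,
      HeckeCharacter.localComponent_eq_valueAtUniformizer
        (HeckeCharacter.isUnramifiedAt_normCharacter v) hϖ,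
      HeckeCharacter.valueAtUniformizer_normCharacter]
  rw [arithFrobPolyOfSatake_one, Multiset.map_singleton, Multiset.prod_singleton, hval]
  have hroot : ι.symm (χ.valueAtUniformizer v * ((v.residueCard : ℂ)⁻¹) ^ k)⁻¹ =
      (v.residueCard : PadicAlgCl ℓ) ^ k * ι.symm (χ.valueAtUniformizer v)⁻¹ := by
    rw [mul_inv, inv_zpow, inv_inv, map_mul, map_zpow₀, map_natCast, mul_comm]
  have h0 : r.HasFrobCharpolyAt v
      (({ι.symm (χ.valueAtUniformizer v)⁻¹} : Multiset (PadicAlgCl ℓ)).map fun b => X - C b).prod := by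
    rw [Multiset.map_singleton, Multiset.prod_singleton]
    exact (hr v hvr).2
  have htw := FramedGaloisRep.hasFrobCharpolyAt_twist_of_eq_prod h0 (χ := ε)
    (c := (v.residueCard : PadicAlgCl ℓ) ^ k)
    (fun 𝔓 h𝔓 σ hσ => coe_apply_of_isArithFrobAt_of_cyclotomic_zpow hε hvℓ h𝔓 hσ)
  rw [Multiset.map_singleton, Multiset.prod_singleton] at htw
  rw [hroot]
  exact htw

/-- **Registered stub `stub_rankOne_weakAutomorphy_of_isOpen_ker_twist` of line `Sketch` (crux
stmt-Langlands-14328, wave N11-J), closed form of `rankOne_weakAutomorphy_of_isOpen_ker_twist`** (all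
binders explicit, in the order `K, ℓ, hcpt, ι, r, hker, k, ε, hε`): for `r : Γ_K → GL₁(ℚ̄_ℓ)` with open
kernel and `ε = ε_ℓ^k`, the twist `r ⊗ ε` is Satake–Frobenius compatible at almost all places with a
cuspidal L-algebraic `π` of `GL₁(𝔸_K)` (the Borel–Jacquet model of `χ‖·‖^k`, `χ` the finite-order
Hecke character of `r` by Artin reciprocity).
[cite: FontaineMazurGeometric1995, Conj. 1 (n = 1)] [cite: SerreAbelianLadic1968, Ch. I §1.2 and Ch. III §2.3]
[cite: BorelJacquet1979, 4.6] -/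
theorem stub_rankOne_weakAutomorphy_of_isOpen_ker_twist :
    ∀ (K : Type) [Field K] [NumberField K] (ℓ : ℕ) [Fact ℓ.Prime]
      (hcpt : isCompact_glFiniteIntegralLevel 1 K) (ι : PadicAlgCl ℓ ≃+* ℂ)
      (r : FramedGaloisRep K (PadicAlgCl ℓ) 1),
      IsOpen (r.toMonoidHom.ker : Set (Field.absoluteGaloisGroup K)) →
      ∀ (k : ℤ) (ε : Field.absoluteGaloisGroup K →ₜ* (PadicAlgCl ℓ)ˣ),
        (∀ σ, (ε σ : PadicAlgCl ℓ) =
          (algebraMap ℚ_[ℓ] (PadicAlgCl ℓ) ((GaloisRep.cyclotomicCharacter K ℓ σ : ℤ_[ℓ]ˣ) : ℤ_[ℓ])) ^ k) →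
        ∃ π : CuspidalAutomorphicRepData 1 K hcpt, π.1.IsLAlgebraic ∧
          ∀ᶠ v : HeightOneSpectrum (𝓞 K) in cofinite, SatakeFrobCompatibleAt ι π.1 (r.twist ε) v := by
  intro _ _ _ _ _ hcpt ι r hker k _ hε
  exact rankOne_weakAutomorphy_of_isOpen_ker_twist hcpt ι r hker k hε

end Summit.Langlands.Langlands.Theorems.ReciprocityUpToIrreducibility

end
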